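import Mathlib
import Literature.RingTheory.Multisymmetric.PowerSumIndependence
import Literature.RingTheory.Multisymmetric.GradedNewton

/-!
# Low-degree freeness of the elementary multisymmetric polynomials

Continuation of `Literature/RingTheory/Multisymmetric/Weyl.lean`, `PowerSumIndependence.lean`,
`GradedNewton.lean` (notation: `n` vectors with coordinates `ι`, `e_α = elemMultisymm ι n α`,
elementary monomials `elemProd ι n s = ∏_α e_α^{s α}` of vector partitions `s`, content
`vpContent s = ∑_α (s α) • α`).

**Theorem** (`elemProd_linearIndependent`).  Over a field of characteristic zero the elementary
monomials `∏_α e_α(t_1,…,t_n)^{s α}` of the vector partitions `s` with nonzero parts and TOTAL CONTENT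
`|vpContent s| ≤ n` are linearly independent.  Equivalently (`aeval_elemMultisymm_ne_zero`): a nonzero
polynomial `Q` in symbols `Z_α` all of whose monomials `∏ Z_α^{s α}` have nonzero parts and weighted
degree `∑_α (s α)|α| ≤ n` does not vanish at `Z_α = e_α(t_1, …, t_n)`; and the same for `Q`
homogeneous in the `Z_α` when the part `α = 0` (`e_0 = 1`) is allowed
(`aeval_elemMultisymm_ne_zero_of_degree_eq`).  The bound is sharp: `e_α = 0` for `|α| > n`.

This is the classical statement that the multisymmetric functions of `n` vectors are generated by the
`e_α`, `|α| ≤ n`, WITHOUT RELATIONS up to degree `n` (P. A. MacMahon, *Combinatory Analysis* II §XI;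
J. Dalbec, Beiträge Algebra Geom. 40 (1999) §1–2; F. Vaccarino, Ann. Inst. Fourier 55 (2005),
Thm. 1; the relations start in degree `n + 1`).  Proof: the power-sum monomials of the admissible
vector partitions are linearly independent (`powerSumProd_linearIndependent`, at most `n` parts) and
lie in the span of the elementary monomials of the same content (`powerSumProd_mem_elemSpan`, graded
Newton); both families are indexed by the same finite set, so a dimension count gives the claim.
-/

noncomputable section

open MvPolynomial

namespace Literature.RingTheory.Multisymmetric

variable {k : Type*} [Field k] (ι : Type*) [Fintype ι] [DecidableEq ι] (n : ℕ)

variable {ι}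

/-- ADMISSIBLE vector partitions for `n` vectors: nonzero parts and total content at most `n`.
[folklore] -/
def VpAdmissible (s : (ι →₀ ℕ) →₀ ℕ) : Prop :=
  (∀ α ∈ s.support, α ≠ 0) ∧ (vpContent s).degree ≤ n

variable {n}

omit [Fintype ι] [DecidableEq ι] in
/-- A part is dominated by the content (times its multiplicity). [folklore] -/
theorem smul_le_vpContent (s : (ι →₀ ℕ) →₀ ℕ) {α : ι →₀ ℕ} (hα : α ∈ s.support) :
    s α • α ≤ vpContent s := by
  unfold vpContent Finsupp.sum
  exact Finset.single_le_sum (f := fun α => s α • α) (fun _ _ => zero_le) hα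

omit [Fintype ι] [DecidableEq ι] in
/-- The number of parts is at most the total content when the parts are nonzero. [folklore] -/
theorem degree_le_degree_vpContent {s : (ι →₀ ℕ) →₀ ℕ} (hs : ∀ α ∈ s.support, α ≠ 0) :
    s.degree ≤ (vpContent s).degree := by
  rw [Finsupp.degree_apply s, vpContent, Finsupp.sum, map_sum]
  refine Finset.sum_le_sum fun α hα => ?_
  rw [map_nsmul, smul_eq_mul]
  have h1 : 1 ≤ α.degree := by
    rw [Nat.one_le_iff_ne_zero, Ne, Finsupp.degree_eq_zero_iff]
    exact hs α hα
  calc s α = s α * 1 := (mul_one _).symm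
    _ ≤ s α * α.degree := Nat.mul_le_mul_left _ h1

omit [DecidableEq ι] in
/-- **Finiteness**: there are finitely many admissible vector partitions. [folklore] -/
theorem vpAdmissible_finite (n : ℕ) : {s : (ι →₀ ℕ) →₀ ℕ | VpAdmissible n s}.Finite := by
  classical
  -- parts are bounded by the constant vector `n`
  set B₀ : ι →₀ ℕ := Finsupp.equivFunOnFinite.symm fun _ => n with hB₀
  set Γ : Finset (ι →₀ ℕ) := Finset.Iic B₀ with hΓ
  set B : (ι →₀ ℕ) →₀ ℕ := ∑ α ∈ Γ, Finsupp.single α n with hB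
  refine Set.Finite.subset (Finset.Iic B).finite_toSet fun s hs => ?_
  rw [Finset.mem_coe, Finset.mem_Iic]
  intro α
  by_cases hα : α ∈ s.support
  · have hle : s α • α ≤ vpContent s := smul_le_vpContent s hα
    have hα0 : α ≠ 0 := hs.1 α hα
    have hsα : 1 ≤ s α := Nat.one_le_iff_ne_zero.mpr (Finsupp.mem_support_iff.mp hα)
    -- `α ∈ Γ`
    have hαΓ : α ∈ Γ := by
      rw [hΓ, Finset.mem_Iic]
      intro i
      have h1 : α i ≤ (s α • α) i := by
        rw [Finsupp.smul_apply, smul_eq_mul]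
        exact Nat.le_mul_of_pos_left _ hsα
      have h2 : (s α • α) i ≤ (vpContent s) i := hle i
      have h3 : (vpContent s) i ≤ (vpContent s).degree := by
        classical
        by_cases hi : i ∈ (vpContent s).support
        · rw [Finsupp.degree_apply]
          exact Finset.single_le_sum (f := fun i => (vpContent s) i) (fun _ _ => zero_le) hi
        · rw [Finsupp.notMem_support_iff.mp hi]; exact zero_le
      have : α i ≤ n := h1.trans (h2.trans (h3.trans hs.2))
      simpa [hB₀] using this
    -- `s α ≤ n = B α`
    have hdeg : s α ≤ n := by
      have h1 : 1 ≤ α.degree := by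
        rw [Nat.one_le_iff_ne_zero, Ne, Finsupp.degree_eq_zero_iff]; exact hα0
      have h2 : (s α • α).degree ≤ (vpContent s).degree := Finsupp.degree_mono hle
      rw [map_nsmul, smul_eq_mul] at h2
      calc s α = s α * 1 := (mul_one _).symm
        _ ≤ s α * α.degree := Nat.mul_le_mul_left _ h1
        _ ≤ n := h2.trans hs.2
    have hBα : B α = n := by
      rw [hB, Finsupp.finsetSum_apply, Finset.sum_eq_single α]
      · exact Finsupp.single_eq_same
      · intro α' _ hne; exact Finsupp.single_eq_of_ne hne.symm
      · intro h; exact absurd hαΓ h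
    rw [hBα]; exact hdeg
  · rw [Finsupp.notMem_support_iff.mp hα]; exact zero_le

/-- The finite type of admissible vector partitions. [folklore] -/
instance vpAdmissible.finite (n : ℕ) : Finite {s : (ι →₀ ℕ) →₀ ℕ // VpAdmissible n s} :=
  (vpAdmissible_finite n).to_subtype

variable (ι n)

/-- Power-sum monomials of admissible vector partitions are linearly independent (at most `n`
parts). [folklore] -/
theorem powerSumProd_linearIndependent_admissible [CharZero k] :
    LinearIndependent k (fun s : {s : (ι →₀ ℕ) →₀ ℕ // VpAdmissible n s} =>
      powerSumProd (k := k) ι n s.1) := by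
  let f : {s : (ι →₀ ℕ) →₀ ℕ // VpAdmissible n s} →
      {s : (ι →₀ ℕ) →₀ ℕ // (∀ β ∈ s.support, β ≠ 0) ∧ s.degree ≤ n} :=
    fun s => ⟨s.1, s.2.1, (degree_le_degree_vpContent s.2.1).trans s.2.2⟩
  have hf : Function.Injective f := fun s t h => Subtype.ext (congrArg (fun x => x.1) h)
  exact (powerSumProd_linearIndependent (k := k) ι n).comp f hf

omit [DecidableEq ι] in
/-- `elemSpan β` is spanned by admissible elementary monomials when `|β| ≤ n`. [folklore] -/
theorem elemSpan_le_span_range (β : ι →₀ ℕ) (hβ : β.degree ≤ n) :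
    elemSpan (k := k) ι n β ≤ Submodule.span k (Set.range
      fun s : {s : (ι →₀ ℕ) →₀ ℕ // VpAdmissible n s} => elemProd (k := k) ι n s.1) := by
  refine Submodule.span_mono ?_
  rintro _ ⟨s, hs, hsβ, rfl⟩
  exact ⟨⟨s, hs, hsβ ▸ hβ⟩, rfl⟩

/-- **Low-degree freeness of the elementary multisymmetric polynomials.**  In characteristic zero
the elementary monomials `∏_α e_α^{s α}` of the admissible vector partitions (nonzero parts, total
content `≤ n`) are linearly independent. [folklore] -/
theorem elemProd_linearIndependent [CharZero k] :
    LinearIndependent k (fun s : {s : (ι →₀ ℕ) →₀ ℕ // VpAdmissible n s} =>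
      elemProd (k := k) ι n s.1) := by
  classical
  haveI : Fintype {s : (ι →₀ ℕ) →₀ ℕ // VpAdmissible n s} := Fintype.ofFinite _
  set E : {s : (ι →₀ ℕ) →₀ ℕ // VpAdmissible n s} → MvPolynomial (ι × Fin n) k :=
    fun s => elemProd ι n s.1 with hE
  set P : {s : (ι →₀ ℕ) →₀ ℕ // VpAdmissible n s} → MvPolynomial (ι × Fin n) k :=
    fun s => powerSumProd ι n s.1 with hP
  have hPind : LinearIndependent k P := powerSumProd_linearIndependent_admissible ι n
  have hle : Submodule.span k (Set.range P) ≤ Submodule.span k (Set.range E) := by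
    rw [Submodule.span_le]
    rintro _ ⟨s, rfl⟩
    have h := powerSumProd_mem_elemSpan (k := k) (ι := ι) (n := n) s.1
    exact elemSpan_le_span_range ι n _ s.2.2 h
  haveI : FiniteDimensional k (Submodule.span k (Set.range E)) :=
    FiniteDimensional.span_of_finite k (Set.finite_range E)
  have hcard : Fintype.card {s : (ι →₀ ℕ) →₀ ℕ // VpAdmissible n s} ≤
      Module.finrank k (Submodule.span k (Set.range E)) := by
    rw [← finrank_span_eq_card hPind]
    exact Submodule.finrank_mono hle
  exact linearIndependent_iff_card_le_finrank_span.mpr hcard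

omit [DecidableEq ι] in
/-- Evaluation of a polynomial in the symbols `Z_α` at `Z_α = e_α` is the corresponding combination of
elementary monomials. [folklore] -/
theorem aeval_elemMultisymm_eq_sum (Q : MvPolynomial (ι →₀ ℕ) k) :
    aeval (elemMultisymm (k := k) ι n) Q = ∑ s ∈ Q.support, coeff s Q • elemProd ι n s := by
  rw [MvPolynomial.aeval_def, MvPolynomial.eval₂_eq]
  refine Finset.sum_congr rfl fun s _ => ?_
  rw [Algebra.smul_def]
  rfl

/-- **No relations of low weighted degree.**  A nonzero polynomial in the symbols `Z_α` whose
monomials are admissible vector partitions (nonzero parts, weighted degree `∑ (s α)|α| ≤ n`) does not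
vanish at `Z_α = e_α(t_1, …, t_n)`. [folklore] -/
theorem aeval_elemMultisymm_ne_zero [CharZero k] {Q : MvPolynomial (ι →₀ ℕ) k}
    (hQ : ∀ s ∈ Q.support, VpAdmissible n s) (hQ0 : Q ≠ 0) :
    aeval (elemMultisymm (k := k) ι n) Q ≠ 0 := by
  classical
  intro h0
  rw [aeval_elemMultisymm_eq_sum] at h0
  have hind := elemProd_linearIndependent (k := k) ι n
  rw [linearIndependent_iff'] at hind
  set T : Finset {s : (ι →₀ ℕ) →₀ ℕ // VpAdmissible n s} := Q.support.subtype (VpAdmissible n)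
    with hT
  have hsum : ∑ s ∈ T, (fun s => coeff s.1 Q) s • elemProd (k := k) ι n s.1 = 0 := by
    rw [hT, Finset.sum_subtype_of_mem (fun s => coeff s Q • elemProd (k := k) ι n s) hQ]
    exact h0
  have hzero := hind T (fun s => coeff s.1 Q) hsum
  obtain ⟨s, hs⟩ := MvPolynomial.ne_zero_iff.mp hQ0
  have hsT : (⟨s, hQ s (mem_support_iff.mpr hs)⟩ : {s // VpAdmissible n s}) ∈ T :=
    Finset.mem_subtype.mpr (mem_support_iff.mpr hs)
  exact hs (hzero _ hsT)

/-! ### Homogeneous polynomials with the part `0` allowed -/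

variable {ι n}

omit [Fintype ι] [DecidableEq ι] in
/-- A vector partition is recovered from its nonzero parts and its number of parts. [folklore] -/
theorem eq_of_erase_zero_eq {s t : (ι →₀ ℕ) →₀ ℕ} (h : s.erase 0 = t.erase 0)
    (hd : s.degree = t.degree) : s = t := by
  classical
  have hs := Finsupp.erase_add_single 0 s
  have ht := Finsupp.erase_add_single 0 t
  have hs' : (s.erase 0).degree + s 0 = s.degree := by
    have := congrArg Finsupp.degree hs
    rwa [map_add, Finsupp.degree_single] at this
  have ht' : (t.erase 0).degree + t 0 = t.degree := by
    have := congrArg Finsupp.degree ht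
    rwa [map_add, Finsupp.degree_single] at this
  have h0 : s 0 = t 0 := by
    have := congrArg Finsupp.degree h
    omega
  rw [← hs, ← ht, h, h0]

/-- **No relations of low weighted degree, homogeneous form.**  A nonzero polynomial in the symbols
`Z_α` (the part `α = 0` allowed, `e_0 = 1`), all of whose monomials have the same number of factors
`D` and weighted degree `∑ (s α)|α| ≤ n`, does not vanish at `Z_α = e_α(t_1, …, t_n)`. [folklore] -/
theorem aeval_elemMultisymm_ne_zero_of_degree_eq [CharZero k] {Q : MvPolynomial (ι →₀ ℕ) k} {D : ℕ}
    (hD : ∀ s ∈ Q.support, s.degree = D) (hQ : ∀ s ∈ Q.support, (vpContent s).degree ≤ n)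
    (hQ0 : Q ≠ 0) : aeval (elemMultisymm (k := k) ι n) Q ≠ 0 := by
  classical
  -- remove the zero parts
  set Qf : MvPolynomial (ι →₀ ℕ) k := ∑ s ∈ Q.support, monomial (s.erase 0) (coeff s Q) with hQf
  have hinj : ∀ s ∈ Q.support, ∀ t ∈ Q.support, s.erase 0 = t.erase 0 → s = t :=
    fun s hs t ht h => eq_of_erase_zero_eq h ((hD s hs).trans (hD t ht).symm)
  have hcoeff : ∀ s ∈ Q.support, coeff (s.erase 0) Qf = coeff s Q := by
    intro s hs
    rw [hQf, coeff_sum, Finset.sum_eq_single s]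
    · rw [coeff_monomial, if_pos rfl]
    · intro t ht hne
      rw [coeff_monomial, if_neg]
      exact fun h => hne (hinj t ht s hs h)
    · intro h; exact absurd hs h
  have heval : aeval (elemMultisymm (k := k) ι n) Qf = aeval (elemMultisymm (k := k) ι n) Q := by
    conv_rhs => rw [aeval_elemMultisymm_eq_sum]
    rw [hQf, map_sum]
    refine Finset.sum_congr rfl fun s _ => ?_
    rw [aeval_monomial, Algebra.smul_def]
    congr 1
    exact elemProd_erase_zero s
  rw [← heval]
  refine aeval_elemMultisymm_ne_zero ι n (fun s' hs' => ?_) ?_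
  · -- monomials of `Qf` are `s.erase 0`
    have : s' ∈ Q.support.biUnion fun s => (monomial (s.erase 0) (coeff s Q)).support := by
      rw [hQf] at hs'
      exact support_sum hs'
    obtain ⟨s, hs, hs's⟩ := Finset.mem_biUnion.mp this
    have hs' : s' = s.erase 0 := by
      have := support_monomial_subset hs's
      rwa [Finset.mem_singleton] at this
    subst hs'
    refine ⟨fun α hα => ?_, ?_⟩
    · rw [Finsupp.support_erase] at hα
      exact Finset.ne_of_mem_erase hα
    · rw [vpContent_erase_zero]; exact hQ s hs
  · obtain ⟨s, hs⟩ := MvPolynomial.ne_zero_iff.mp hQ0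
    have hs' : s ∈ Q.support := mem_support_iff.mpr hs
    rw [MvPolynomial.ne_zero_iff]
    exact ⟨s.erase 0, by rw [hcoeff s hs']; exact hs⟩

end Literature.RingTheory.Multisymmetric
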